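import Summits.BirchSwinnertonDyer.BirchSwinnertonDyer.Theorems.GenusKolyvaginAtTwoPowDvdShaCardAtTwoRTFixedPartCyclic
import Summits.BirchSwinnertonDyer.BirchSwinnertonDyer.Theorems.GenusKolyvaginAtTwoCyclicTorsionOfNegDisc
import HarnessLib

/-!
# Route `GenusKolyvaginAtTwo`, LINE 18 «plus_descent» on crux L_T `PowDvdShaCardAtTwoRT`
# (stmt-BirchSwinnertonDyer-23242): `CyclicFixedPartOfNegDisc` holds UNCONDITIONALLY

Seat `bsd-line-gk2-p3` g15 (cell `bsd-f1-sign2`), `--supports stmt-BirchSwinnertonDyer-23242` (helper; closes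
nothing). THEOREMS ONLY. The registered stub `stub_fixedPartCyclic` (proved in the sibling
`…PowDvdShaCardAtTwoRTFixedPartCyclic`, route-independent) fed with the CLOSED route item Q1
`CyclicTorsionOfNegDisc` (item 24879, `GenusCyclicTorsion.cyclicTorsionOfNegDisc_proof`): for every elliptic `E/ℚ`
with `Δ < 0`, every complex conjugation `c₀ ∈ Γ_ℚ` and every `M`, the `c₀`-fixed subgroup of `E[2^M]` is cyclic
of order `2^M` — so the skeleton's hypothesis `CyclicFixedPartOfNegDisc` of `stub_plusLadder` is a theorem.
BSD is not proved by any of this.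

References: [GrossLMS1991] §3 (3.3), §4; [McCallumLMS1991] Lemma 5.3.
-/

set_option autoImplicit false
set_option linter.dupNamespace false

noncomputable section

namespace Summit.BirchSwinnertonDyer.BirchSwinnertonDyer.Theorems.GenusExact.PlusDescent

open WeierstrassCurve Field

/-- **`CyclicFixedPartOfNegDisc` holds, unconditionally**: for every elliptic `E/ℚ` with `Δ < 0`, every
complex conjugation `c₀ ∈ Γ_ℚ` and every `M`, some `P ∈ E[2^M]` of order `2^M` generates the `c₀`-fixed subgroup
of `E[2^M]` (the stub `cyclicFixedPart_of_cyclicTorsion` applied to the closed Q1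
`GenusCyclicTorsion.cyclicTorsionOfNegDisc_proof`). [cite: GrossLMS1991, §3 (3.3) and §4]
[cite: McCallumLMS1991, Lemma 5.3] -/
theorem cyclicFixedPartOfNegDisc_holds :
    ∀ (W : WeierstrassCurve ℚ) [W.IsElliptic], W.Δ < 0 → ∀ (c₀ : Field.absoluteGaloisGroup ℚ),
      Literature.NumberTheory.GaloisRepresentations.IsComplexConjugation (Rat.castHom ℝ) c₀ → ∀ (M : ℕ),
      ∃ P : W.geomTorsion ((2 ^ M : ℕ) : ℤ), addOrderOf P = 2 ^ M ∧
        ∀ Q : W.geomTorsion ((2 ^ M : ℕ) : ℤ), c₀ • Q = Q ↔ Q ∈ AddSubgroup.zmultiples P :=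
  cyclicFixedPart_of_cyclicTorsion GenusCyclicTorsion.cyclicTorsionOfNegDisc_proof

end Summit.BirchSwinnertonDyer.BirchSwinnertonDyer.Theorems.GenusExact.PlusDescent

end
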